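import Summits.SmoothPoincare4.SmoothPoincare4.Theorems.RootDecompAEDoublesShadowLEOnePeelLocalStep

/-!
# Peeling theorem for KMN encoding graphs, part 6/8: certificates and the combination step

§7 (third part) `Cert rows cols lo`: an injective owner map rows → used letters, ranks `≥ lo` and signs such that
every row, signed and with the non-used letters and the letters ranked below its owner erased, equals its owner
letter.  `combine` merges local certificate data at a peeled piece `u` with a certificate of the remaining state.
The set algebra of one peeling step (`rows_split_top`, `rows_split_bot`).

THE FAMILY (eight modules `Theorems/RootDecompAEDoublesShadowLEOnePeel*.lean` + the closing module
`Theorems/RootDecompAEDoublesShadowLEOneStubPeelCertificates.lean`, one namespace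
`Summit.SmoothPoincare4.SmoothPoincare4.Theorems.RootDecompAEDoublesShadowLEOneStubPeelCertificates`, split by topic to respect the
400-line bound on proof files): `…PeelDefs` (verbatim twins of the skeleton's `Piece`, `ShadowGraph`,
`PeelCertificates`; free-group exponent sums; `H₁ = 0 ⟹` unimodular exponent matrix) · `…PeelBlocks` (unimodular
finset-indexed blocks of an integer table: splitting and rank bounds; the tree of pieces and its leaves) ·
`…PeelLocalTable` (the local table (★) of the twelve pieces) · `…PeelTable` (exponent sums of the relators of `P(G)`;
rows and used letters of a peeling state) · `…PeelLocalStep` (the geometry of a gluing at a piece; local certificate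
data from local unimodularity) · `…PeelCombine` (certificates of peeling states; the combination step; the set
algebra of one peeling step) · `…PeelRecursion` (the peeling recursion; the unimodular start) ·
`…StubPeelCertificates` (step L0 and the extraction: `theorem stub_peelCertificates : PeelCertificates`).
-/

open Function
open Literature.Topology.FourManifolds

set_option linter.dupNamespace false

noncomputable section

namespace Summit.SmoothPoincare4.SmoothPoincare4.Theorems.RootDecompAEDoublesShadowLEOneStubPeelCertificates

namespace ShadowGraph

variable (G : ShadowGraph)

/-! ### Certificates of a peeling state and the combination step -/

/-- The ERASING SUBSTITUTION attached to an owner letter `g₀`: kill the letters outside `cols` and those of rank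
below `rk g₀`. -/
def erase (cols : Finset G.Gen) (rk : G.Gen → ℕ) (g₀ : G.Gen) : G.Gen → FreeGroup G.Gen :=
  fun g => if g ∉ cols ∨ rk g < rk g₀ then 1 else FreeGroup.of g

/-- CERTIFICATE of a peeling state: an injective owner map `rows → cols`, ranks `≥ lo` on `cols`, and signs, such
that every row, signed and erased below its owner, IS its owner letter. -/
def Cert (rows : Finset (Fin G.m)) (cols : Finset G.Gen) (lo : ℕ) : Prop :=
  ∃ (lam : Fin G.m → G.Gen) (rk : G.Gen → ℕ) (sg : Fin G.m → Bool),
    (∀ r₁ ∈ rows, ∀ r₂ ∈ rows, lam r₁ = lam r₂ → r₁ = r₂) ∧ (∀ r ∈ rows, lam r ∈ cols) ∧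
      (∀ g ∈ cols, lo ≤ rk g) ∧
        ∀ r ∈ rows, FreeGroup.lift (G.erase cols rk (lam r)) (sgnw (sg r) (G.gluingRelator r)) = FreeGroup.of (lam r)

variable {G}

/-- THE COMBINATION STEP: local certificate data at the peeled piece `u` (with `u`-letters ranked from `base`) and a
certificate of the remaining state (ranks `≥ lo'`) combine to a certificate of the whole state (ranks `≥ lo`). -/
theorem combine (hself : ∀ e, (G.src e).1 ≠ (G.tgt e).1) (R L L' : Finset (Fin G.k)) (u : Fin G.k) (hu : u ∈ R)
    (ru : Finset (Fin G.m)) (hru : ∀ e ∈ ru, (G.src e).1 = u ∨ (G.tgt e).1 = u)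
    (hrows : G.rows R L = ru ∪ G.rows (R.erase u) L') (hdisj : Disjoint ru (G.rows (R.erase u) L'))
    (lo lo' base : ℕ) (hlo : lo ≤ base) (hlo' : lo ≤ lo')
    (hr' : (∀ e ∈ G.rows (R.erase u) L', (G.src e).1 ≠ u ∧ (G.tgt e).1 ≠ u) ∨ base + 2 ≤ lo')
    (lam' : Fin G.m → G.Gen) (rk' : G.Gen → ℕ) (sg' : Fin G.m → Bool)
    (hinj' : ∀ r₁ ∈ G.rows (R.erase u) L', ∀ r₂ ∈ G.rows (R.erase u) L', lam' r₁ = lam' r₂ → r₁ = r₂)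
    (hmem' : ∀ r ∈ G.rows (R.erase u) L', lam' r ∈ G.cols (R.erase u))
    (hlo'' : ∀ g ∈ G.cols (R.erase u), lo' ≤ rk' g)
    (hval' : ∀ r ∈ G.rows (R.erase u) L',
      FreeGroup.lift (G.erase (G.cols (R.erase u)) rk' (lam' r)) (sgnw (sg' r) (G.gluingRelator r)) =
        FreeGroup.of (lam' r))
    (hfar : ∀ e ∈ ru, ∀ i : Fin 2,
      (Sum.inl (G.other e u, i) : G.Gen) ∈ G.cols (R.erase u) → rk' (Sum.inl (G.other e u, i)) < base)
    (lamU : Fin G.m → Fin 2) (tU : Fin G.m → Bool) (lr : Fin 2 → ℕ) (hloc : G.LocalData u ru lamU tU lr) :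
    G.Cert (G.rows R L) (G.cols R) lo := by
  classical
  obtain ⟨hinjU, hlr2, hlamU, hunused, hvalU⟩ := hloc
  obtain ⟨lam, hlam⟩ : ∃ lam : Fin G.m → G.Gen, ∀ e, lam e = if e ∈ ru then Sum.inl (u, lamU e) else lam' e :=
    ⟨_, fun _ => rfl⟩
  obtain ⟨rk, hrk⟩ : ∃ rk : G.Gen → ℕ, ∀ g, rk g =
      Sum.elim (fun p : Fin G.k × Fin 2 => if p.1 = u then base + lr p.2 else rk' (Sum.inl p)) (fun e => rk' (Sum.inr e)) g :=
    ⟨_, fun _ => rfl⟩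
  obtain ⟨sg, hsg⟩ : ∃ sg : Fin G.m → Bool, ∀ e, sg e = if e ∈ ru then xor (tU e) (G.uflip e u) else sg' e :=
    ⟨_, fun _ => rfl⟩
  have hrk_u : ∀ j, rk (Sum.inl (u, j)) = base + lr j := fun j => by simp [hrk]
  have hrk_v : ∀ v, v ≠ u → ∀ j, rk (Sum.inl (v, j)) = rk' (Sum.inl (v, j)) := fun v hv j => by simp [hrk, hv]
  have hcols' : ∀ g ∈ G.cols (R.erase u), ∃ v i, g = Sum.inl (v, i) ∧ v ≠ u ∧ v ∈ R := by
    intro g hg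
    obtain ⟨v, i, rfl, hv, -⟩ := (G.mem_cols_iff _ _).mp hg
    exact ⟨v, i, rfl, (Finset.mem_erase.mp hv).1, (Finset.mem_erase.mp hv).2⟩
  have hrk_c' : ∀ g ∈ G.cols (R.erase u), rk g = rk' g := by
    intro g hg
    obtain ⟨v, i, rfl, hv, -⟩ := hcols' g hg
    exact hrk_v v hv i
  have hnot_ru : ∀ e ∈ G.rows (R.erase u) L', e ∉ ru := fun e he hm => Finset.disjoint_left.mp hdisj hm he
  refine ⟨lam, rk, sg, ?_, ?_, ?_, ?_⟩
  · -- injectivity of the owner map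
    intro r₁ h₁ r₂ h₂ heq
    rw [hrows, Finset.mem_union] at h₁ h₂
    rw [hlam, hlam] at heq
    by_cases m₁ : r₁ ∈ ru <;> by_cases m₂ : r₂ ∈ ru
    · rw [if_pos m₁, if_pos m₂] at heq
      simp only [Sum.inl.injEq, Prod.mk.injEq, true_and] at heq
      exact hinjU r₁ m₁ r₂ m₂ heq
    · rw [if_pos m₁, if_neg m₂] at heq
      have h₂' := h₂.resolve_left m₂
      obtain ⟨v, i, hv, hvu, -⟩ := hcols' _ (hmem' r₂ h₂')
      rw [hv] at heq
      simp only [Sum.inl.injEq, Prod.mk.injEq] at heq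
      exact absurd heq.1.symm hvu
    · rw [if_neg m₁, if_pos m₂] at heq
      have h₁' := h₁.resolve_left m₁
      obtain ⟨v, i, hv, hvu, -⟩ := hcols' _ (hmem' r₁ h₁')
      rw [hv] at heq
      simp only [Sum.inl.injEq, Prod.mk.injEq] at heq
      exact absurd heq.1 hvu
    · rw [if_neg m₁, if_neg m₂] at heq
      exact hinj' r₁ (h₁.resolve_left m₁) r₂ (h₂.resolve_left m₂) heq
  · -- owners are used letters
    intro r hr
    rw [hrows, Finset.mem_union] at hr
    rw [hlam]
    by_cases m : r ∈ ru
    · rw [if_pos m, inl_mem_cols]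
      exact ⟨hu, hlamU r m⟩
    · rw [if_neg m]
      exact G.cols_mono (Finset.erase_subset u R) (hmem' r (hr.resolve_left m))
  · -- ranks are at least `lo`
    intro g hg
    obtain ⟨v, i, rfl, hv, hi⟩ := (G.mem_cols_iff _ _).mp hg
    by_cases hvu : v = u
    · subst hvu; rw [hrk_u]; omega
    · rw [hrk_v v hvu]
      have : (Sum.inl (v, i) : G.Gen) ∈ G.cols (R.erase u) :=
        (G.inl_mem_cols _ _ _).mpr ⟨Finset.mem_erase.mpr ⟨hvu, hv⟩, hi⟩
      exact le_trans hlo' (hlo'' _ this)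
  · -- validity
    intro r hr
    rw [hrows, Finset.mem_union] at hr
    by_cases m : r ∈ ru
    · -- a row at `u`: evaluate, the far letters die, the `u`-letters follow the local certificate
      have hlr : lam r = Sum.inl (u, lamU r) := by rw [hlam, if_pos m]
      have hsr : sg r = xor (tU r) (G.uflip r u) := by rw [hsg, if_pos m]
      rw [hlr, hsr]
      set F := G.erase (G.cols R) rk (Sum.inl (u, lamU r)) with hF
      have hFe : F (Sum.inr r) = 1 := by simp [hF, erase, inr_not_mem_cols]
      have hFw : ∀ i, F (Sum.inl (G.other r u, i)) = 1 := by
        intro i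
        have hc : (Sum.inl (G.other r u, i) : G.Gen) ∉ G.cols R ∨
            rk (Sum.inl (G.other r u, i)) < rk (Sum.inl (u, lamU r)) := by
          by_cases hmem : (Sum.inl (G.other r u, i) : G.Gen) ∈ G.cols R
          · right
            have hne : G.other r u ≠ u := other_ne (hself r)
            have hmem' : (Sum.inl (G.other r u, i) : G.Gen) ∈ G.cols (R.erase u) := by
              rw [inl_mem_cols] at hmem ⊢
              exact ⟨Finset.mem_erase.mpr ⟨hne, hmem.1⟩, hmem.2⟩
            rw [hrk_v _ hne, hrk_u]
            have := hfar r m i hmem'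
            omega
          · exact Or.inl hmem
        simp only [hF, erase]
        rw [if_pos hc]
      rw [hom_sgnw, lift_rel_u (hru r m) (hself r) F hFe hFw, sgnw_sgnw]
      have hx : xor (xor (tU r) (G.uflip r u)) (G.uflip r u) = tU r := by
        cases tU r <;> cases G.uflip r u <;> rfl
      rw [hx, ← hom_sgnw (FreeGroup.lift (F ∘ G.ltr u))]
      have hFu : F ∘ G.ltr u = ⇑(FreeGroup.map (G.ltr u)) ∘
          (fun j : Fin 2 => if lr j < lr (lamU r) then (1 : FreeGroup (Fin 2)) else FreeGroup.of j) := by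
        funext j
        simp only [Function.comp_apply, hF, erase, ltr]
        rw [hrk_u, hrk_u]
        by_cases hj : (j : ℕ) < (G.piece u).rank
        · have hmem : (Sum.inl (u, j) : G.Gen) ∈ G.cols R := (G.inl_mem_cols _ _ _).mpr ⟨hu, hj⟩
          by_cases hlt : lr j < lr (lamU r)
          · rw [if_pos (Or.inr (by omega)), if_pos hlt, map_one]
          · rw [if_neg (by push Not; exact ⟨hmem, by omega⟩), if_neg hlt, FreeGroup.map.of]
            rfl
        · have hmem : (Sum.inl (u, j) : G.Gen) ∉ G.cols R := fun h => hj ((G.inl_mem_cols _ _ _).mp h).2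
          have hlt : lr j < lr (lamU r) := hunused j (not_lt.mp hj) r m
          rw [if_pos (Or.inl hmem), if_pos hlt, map_one]
      rw [hFu, ← hom_lift_eq (FreeGroup.map (G.ltr u)), hvalU r m, FreeGroup.map.of]
      rfl
    · -- a row of the remaining state: the two substitutions agree on everything the relator sees
      have hrow' := hr.resolve_left m
      have hlr : lam r = lam' r := by rw [hlam, if_neg m]
      have hsr : sg r = sg' r := by rw [hsg, if_neg m]
      rw [hlr, hsr]
      have hlam'c := hmem' r hrow'
      have hrkl : rk (lam' r) = rk' (lam' r) := hrk_c' _ hlam'c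
      have agree : ∀ v, ((G.src r).1 = v ∨ (G.tgt r).1 = v) → ∀ i,
          G.erase (G.cols R) rk (lam' r) (Sum.inl (v, i)) =
            G.erase (G.cols (R.erase u)) rk' (lam' r) (Sum.inl (v, i)) := by
        intro v hv i
        simp only [erase]
        rw [hrkl]
        by_cases hvu : v = u
        · rw [hvu] at hv ⊢
          have h2 : base + 2 ≤ lo' := by
            rcases hr' with hA | hB
            · exact (hv.elim (hA r hrow').1 (hA r hrow').2).elim
            · exact hB
          have hge := hlo'' _ hlam'c
          have hl2 := hlr2 i
          rw [hrk_u, if_pos (Or.inr (by omega)), if_pos (Or.inl (G.inl_not_mem_cols_erase R u i))]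
        · rw [hrk_v v hvu]
          have hiff : (Sum.inl (v, i) : G.Gen) ∈ G.cols R ↔ (Sum.inl (v, i) : G.Gen) ∈ G.cols (R.erase u) := by
            rw [inl_mem_cols, inl_mem_cols, Finset.mem_erase]
            tauto
          simp only [hiff]
      rw [hom_sgnw, G.lift_gluingRelator_congr _ _ r (agree _ (Or.inl rfl)) (agree _ (Or.inr rfl))
        (by simp [erase, inr_not_mem_cols]), ← hom_sgnw]
      exact hval' r hrow'

end ShadowGraph

namespace ShadowGraph

variable (G : ShadowGraph)

/-! ### The set algebra of one peeling step -/

/-- The rows at `u`. -/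
def urows (R L : Finset (Fin G.k)) (u : Fin G.k) : Finset (Fin G.m) :=
  (G.rows R L).filter fun e => (G.src e).1 = u ∨ (G.tgt e).1 = u

variable {G}

/-- Membership in the rows at `u`. -/
theorem mem_urows {R L : Finset (Fin G.k)} {u : Fin G.k} {e : Fin G.m} :
    e ∈ G.urows R L u ↔ e ∈ G.rows R L ∧ ((G.src e).1 = u ∨ (G.tgt e).1 = u) := by
  simp [urows]

/-- The far end of a row at `u` lies in `R` or in `L`. -/
theorem other_mem {R L : Finset (Fin G.k)} {u : Fin G.k} {e : Fin G.m}
    (he : e ∈ G.rows R L) (ht : (G.src e).1 = u ∨ (G.tgt e).1 = u) :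
    G.other e u ∈ R ∨ G.other e u ∈ L := by
  rw [mem_rows] at he
  rcases ends_eq ht with ⟨h1, h2⟩ | ⟨h1, h2⟩
  · rw [← h2]
    rcases he with ⟨-, h⟩ | ⟨h, -⟩
    · exact h
    · exact Or.inl h
  · rw [← h2]
    rcases he with ⟨h, -⟩ | ⟨-, h⟩
    · exact Or.inl h
    · exact h

/-- TOP split of the rows: the rows at `u`, and the rows of the state `(R ∖ u, L)`, which avoid `u`. -/
theorem rows_split_top {R L : Finset (Fin G.k)} {u : Fin G.k} (huL : u ∉ L) :
    G.rows R L = G.urows R L u ∪ G.rows (R.erase u) L ∧ Disjoint (G.urows R L u) (G.rows (R.erase u) L) ∧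
      ∀ e ∈ G.rows (R.erase u) L, (G.src e).1 ≠ u ∧ (G.tgt e).1 ≠ u := by
  have havoid : ∀ e ∈ G.rows (R.erase u) L, (G.src e).1 ≠ u ∧ (G.tgt e).1 ≠ u := by
    intro e he
    rw [mem_rows] at he
    simp only [Finset.mem_erase] at he
    constructor
    · rintro h
      rcases he with ⟨⟨h1, -⟩, -⟩ | ⟨-, ⟨h1, -⟩ | h1⟩
      · exact h1 h
      · exact h1 h
      · exact huL (h ▸ h1)
    · rintro h
      rcases he with ⟨-, ⟨h1, -⟩ | h1⟩ | ⟨⟨h1, -⟩, -⟩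
      · exact h1 h
      · exact huL (h ▸ h1)
      · exact h1 h
  refine ⟨?_, ?_, havoid⟩
  · ext e
    rw [Finset.mem_union, mem_urows]
    constructor
    · intro he
      by_cases ht : (G.src e).1 = u ∨ (G.tgt e).1 = u
      · exact Or.inl ⟨he, ht⟩
      · right
        push Not at ht
        rw [mem_rows] at he ⊢
        simp only [Finset.mem_erase]
        tauto
    · rintro (⟨he, -⟩ | he)
      · exact he
      · rw [mem_rows] at he ⊢
        simp only [Finset.mem_erase] at he
        tauto
  · rw [Finset.disjoint_left]
    intro e he he'
    rw [mem_urows] at he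
    have := havoid e he'
    tauto

/-- BOTTOM split of the rows: the cap rows `S` at `u` (all rows at `u` except the edge `δ` towards `R`), and the
rows of the state `(R ∖ u, L ∪ {u})`. -/
theorem rows_split_bot {R L : Finset (Fin G.k)} {u : Fin G.k} (hself : ∀ e, (G.src e).1 ≠ (G.tgt e).1)
    (hRL : Disjoint R L) (hu : u ∈ R) (δ : Fin G.m) (hδ : δ ∈ G.urows R L u) (hδR : G.other δ u ∈ R)
    (hS : ∀ e ∈ G.urows R L u, e ≠ δ → G.other e u ∈ L) :
    G.rows R L = (G.urows R L u).erase δ ∪ G.rows (R.erase u) (insert u L) ∧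
      Disjoint ((G.urows R L u).erase δ) (G.rows (R.erase u) (insert u L)) := by
  have huL : u ∉ L := fun h => Finset.disjoint_left.mp hRL hu h
  constructor
  · ext e
    rw [Finset.mem_union, Finset.mem_erase, mem_urows]
    constructor
    · intro he
      by_cases ht : (G.src e).1 = u ∨ (G.tgt e).1 = u
      · by_cases hed : e = δ
        · right
          subst hed
          have hne : G.other e u ≠ u := other_ne (hself e)
          rw [mem_rows]
          simp only [Finset.mem_erase, Finset.mem_insert]
          rcases ends_eq ht with ⟨h1, h2⟩ | ⟨h1, h2⟩
          · right; refine ⟨⟨?_, ?_⟩, Or.inr (Or.inl h1)⟩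
            · rw [h2]; exact hne
            · rw [h2]; exact hδR
          · left; refine ⟨⟨?_, ?_⟩, Or.inr (Or.inl h1)⟩
            · rw [h2]; exact hne
            · rw [h2]; exact hδR
        · exact Or.inl ⟨hed, he, ht⟩
      · right
        push Not at ht
        rw [mem_rows] at he ⊢
        simp only [Finset.mem_erase, Finset.mem_insert]
        tauto
    · rintro (⟨-, he, -⟩ | he)
      · exact he
      · rw [mem_rows] at he ⊢
        simp only [Finset.mem_erase, Finset.mem_insert] at he
        rcases he with ⟨⟨-, h1⟩, ⟨-, h2⟩ | rfl | h2⟩ | ⟨⟨-, h1⟩, ⟨-, h2⟩ | rfl | h2⟩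
        · exact Or.inl ⟨h1, Or.inl h2⟩
        · exact Or.inr ⟨hu, Or.inl h1⟩
        · exact Or.inl ⟨h1, Or.inr h2⟩
        · exact Or.inr ⟨h1, Or.inl h2⟩
        · exact Or.inl ⟨hu, Or.inl h1⟩
        · exact Or.inr ⟨h1, Or.inr h2⟩
  · rw [Finset.disjoint_left]
    intro e he he'
    rw [Finset.mem_erase, mem_urows] at he
    obtain ⟨hed, heR, ht⟩ := he
    have hoL := hS e (mem_urows.mpr ⟨heR, ht⟩) hed
    have hoR : G.other e u ∉ R.erase u := fun h =>
      Finset.disjoint_left.mp hRL (Finset.mem_of_mem_erase h) hoL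
    have huR : u ∉ R.erase u := by simp
    rw [mem_rows] at he'
    rcases ends_eq ht with ⟨h1, h2⟩ | ⟨h1, h2⟩
    · rw [h1, h2] at he'
      rcases he' with ⟨h, -⟩ | ⟨h, -⟩
      · exact huR h
      · exact hoR h
    · rw [h1, h2] at he'
      rcases he' with ⟨h, -⟩ | ⟨h, -⟩
      · exact hoR h
      · exact huR h

end ShadowGraph

end Summit.SmoothPoincare4.SmoothPoincare4.Theorems.RootDecompAEDoublesShadowLEOneStubPeelCertificates
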